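import Literature.AlgebraicGeometry.Motives.MixedHodgeStructureProd
import Literature.AlgebraicGeometry.Motives.MixedHodgeStructureEndBigrading
import Mathlib.RingTheory.Nilpotent.Exp
import HarnessLib

/-!
# Direct sums of endomorphisms of complexified Hodge structures: `A ⊕ B` on `(V × V')_ℂ`

Topic `Literature/AlgebraicGeometry/Motives` (namespace `Literature.AlgebraicGeometry.Motives.HodgeStructure`), lane `lit-hodgefound`
(seat `p08`, row g60-#1).  The ADDITIVE twin of `Motives/MixedHodgeStructureTensorEndomorphisms` (`tensorEnd A B = A ⊗ B` on
`(V ⊗ V')_ℂ`).  Cattani–El Zein–Griffiths–Lê, *Hodge Theory* (Math. Notes 49), Thm. 3.2.18 / Ex. 3.2.23 (2): mixed Hodge structures form an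
abelian category, the direct sum `H₁ ⊕ H₂` carrying the product filtrations `W_k(H₁) × W_k(H₂)`, `F^p(H₁) × F^p(H₂)`; Thm. 7.5.6: Deligne's
bigrading `I^{p,q}` is functorial — for the direct sum `I^{p,q}(H₁ ⊕ H₂) = I^{p,q}(H₁) × I^{p,q}(H₂)` (the tree's
`MixedHodgeStructure.deligneI_prod`), so with (7.6.2), `𝔤𝔩(V)^{a,b} = {X : X(I^{p,q}) ⊂ I^{p+a,q+b}}`, a pair `A ∈ 𝔤𝔩(V)^{a,b}`,
`B ∈ 𝔤𝔩(V')^{a,b}` gives the block-diagonal endomorphism `A ⊕ B ∈ 𝔤𝔩(V × V')^{a,b}`.  Deligne, *La conjecture de Weil II*, (1.6.7): the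
monodromy filtration of a direct sum is the direct sum (`N = N₁ ⊕ N₂`); Kato, *On SL(2)-orbit theorems*, §2.1, 6: Deligne–Hodge systems
«have direct sum, tensor products, … defined in the evident manners».  The tree realizes `(H₁ ⊕ H₂)_ℂ` as `ℂ ⊗ (V × V')` with the
identification `prodEquiv : ℂ ⊗ (V × V') ≃ V_ℂ × V'_ℂ` (`Motives/HodgeStructure`) and `MixedHodgeStructure.prod`, `prod_F`, `deligneI_prod`
(`Motives/MixedHodgeStructureProd`).  THIS FILE supplies the endomorphism side of that dictionary, used by the direct sum of limit mixed Hodge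
structures and of local period charts (monodromy logarithm `N₁ ⊕ N₂`, gauges `Γ₁(s) ⊕ Γ₂(s)`, frames `h₁(c) ⊕ h₂(c)`, twists
`e^{X₁} ⊕ e^{X₂}`):

* §1 **`HodgeStructure.prodEnd A B`** — the endomorphism `A ⊕ B` of `ℂ ⊗ (V × V')` (Mathlib's `LinearMap.prodMap A B` on `V_ℂ × V'_ℂ`
  transported along `prodEquiv`): multiplicativity, unit, additivity, scalars, powers, the splitting `A ⊕ B = (A ⊕ 0) + (0 ⊕ B)` into
  commuting summands, injectivity `A ⊕ B = A' ⊕ B' ↔ A = A' ∧ B = B'`, nilpotency (iff), invertibility, the ring homomorphism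
  `prodEndRingHom : End × End → End` and the exponential **`exp(A ⊕ B) = e^A ⊕ e^B`** (`exp_prodEnd`), REALITY **`conj(A ⊕ B) = Ā ⊕ B̄`**
  (`endConj_prodEnd`), and BASE CHANGE **`(f ⊕ g)_ℂ = f_ℂ ⊕ g_ℂ`** (`baseChange_prodMap_eq_prodEnd`); on the rational side
  **`exp(N₁ ⊕ N₂) = e^{N₁} ⊕ e^{N₂}`** (`exp_prodMap`, through Mathlib's `LinearMap.prodMapRingHom`).
* §2 subspaces: **`(A ⊕ B)(S × U) = A S × B U`** (`map_prodEnd_comap_prod`), preimages (`comap_prodEnd_comap_prod`), hence the action on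
  the product filtrations of `H₁ ⊕ H₂` (`map_prodEnd_prod_F`, `map_prodEnd_prod_F_le`, `map_prodEnd_baseChange_prod_W_le`) and Thm. 7.5.6 /
  (7.6.2): **`prodEnd_mem_endPiece_iff`** (`A ⊕ B ∈ 𝔤𝔩(H₁ ⊕ H₂)^{a,b} ↔ A ∈ 𝔤𝔩(H₁)^{a,b} ∧ B ∈ 𝔤𝔩(H₂)^{a,b}`) and the version for the sums
  `⊕_{(a,b) ∈ P} 𝔤𝔩^{a,b}` (`prodEnd_mem_biSup_endPiece`, e.g. `P = {a ≤ -1}`: the gauge algebra `𝔟`).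

Everything is proved; the definitions (with bodies) are `prodEnd` and `prodEndRingHom`; no instance, no named fact (D-0026 net debt `0`).
Not here: off-diagonal blocks `Hom(V_ℂ, V'_ℂ)` of `End((V × V')_ℂ)` (only block-DIAGONAL endomorphisms are needed for direct sums of charts).

## References
* [CattaniElZeinGriffithsLe2014] E. Cattani et al. (eds.), *Hodge Theory* (2014): Thm. 3.2.18, Ex. 3.2.23 (2) (p. 163), Thm. 7.5.6, (7.6.2),
  Def. 7.5.4 (exponentials of nilpotent twists).
* [Deligne1980] P. Deligne, *La conjecture de Weil. II*, Publ. Math. IHÉS 52 (1980), (1.6.7).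
* [Kato2013] K. Kato, *On SL(2)-orbit theorems*, Kyoto J. Math. 54 (2014), §2.1, 6.
* [DeligneHodgeII1971] P. Deligne, *Théorie de Hodge II*, 2.1 (direct sums), 2.1.4 (the real structure / conjugation).
* [KatoUsui2009] K. Kato, S. Usui, Ann. of Math. Stud. 169, §6.1.2 (endomorphisms "defined over `ℝ`").
-/

noncomputable section

open scoped TensorProduct

universe u v

namespace Literature.AlgebraicGeometry.Motives

namespace HodgeStructure

variable {V : Type u} [AddCommGroup V] [Module ℚ V] {V' : Type v} [AddCommGroup V'] [Module ℚ V']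

/-! ## §1 The endomorphism `A ⊕ B` of `ℂ ⊗ (V × V')` -/

/-- **`A ⊕ B` on `(V × V')_ℂ = ℂ ⊗ (V × V')`**: the block-diagonal endomorphism `LinearMap.prodMap A B` of `V_ℂ × V'_ℂ`, transported
along `prodEquiv : ℂ ⊗ (V × V') ≃ V_ℂ × V'_ℂ` (the direct sum of two endomorphisms in the additive category of Thm. 3.2.18).
[cite: CattaniElZeinGriffithsLe2014, Thm. 3.2.18 and Ex. 3.2.23 (2)] -/
def prodEnd (A : Module.End ℂ (ℂ ⊗[ℚ] V)) (B : Module.End ℂ (ℂ ⊗[ℚ] V')) : Module.End ℂ (ℂ ⊗[ℚ] (V × V')) :=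
  ((prodEquiv V V').symm : (ℂ ⊗[ℚ] V) × (ℂ ⊗[ℚ] V') →ₗ[ℂ] ℂ ⊗[ℚ] (V × V')) ∘ₗ A.prodMap B ∘ₗ
    (prodEquiv V V' : ℂ ⊗[ℚ] (V × V') →ₗ[ℂ] (ℂ ⊗[ℚ] V) × (ℂ ⊗[ℚ] V'))

section Algebra

variable (A A' : Module.End ℂ (ℂ ⊗[ℚ] V)) (B B' : Module.End ℂ (ℂ ⊗[ℚ] V'))

/-- `(A ⊕ B) z = ι⁻¹ (A (ι z)₁, B (ι z)₂)`, `ι = prodEquiv`. [cite: CattaniElZeinGriffithsLe2014, Ex. 3.2.23 (2)] -/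
theorem prodEnd_apply (z : ℂ ⊗[ℚ] (V × V')) :
    prodEnd A B z = (prodEquiv V V').symm (A (prodEquiv V V' z).1, B (prodEquiv V V' z).2) := rfl

/-- `ι ((A ⊕ B) z) = (A (ι z)₁, B (ι z)₂)`. [cite: CattaniElZeinGriffithsLe2014, Ex. 3.2.23 (2)] -/
@[simp]
theorem prodEquiv_prodEnd_apply (z : ℂ ⊗[ℚ] (V × V')) :
    prodEquiv V V' (prodEnd A B z) = (A (prodEquiv V V' z).1, B (prodEquiv V V' z).2) := by
  rw [prodEnd_apply, LinearEquiv.apply_symm_apply]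

/-- `(A ⊕ B)(ι⁻¹(x, y)) = ι⁻¹(A x, B y)`. [cite: CattaniElZeinGriffithsLe2014, Ex. 3.2.23 (2)] -/
@[simp]
theorem prodEnd_symm_mk (x : ℂ ⊗[ℚ] V) (y : ℂ ⊗[ℚ] V') :
    prodEnd A B ((prodEquiv V V').symm (x, y)) = (prodEquiv V V').symm (A x, B y) := by
  rw [prodEnd_apply, LinearEquiv.apply_symm_apply]

/-- Two endomorphisms of `ℂ ⊗ (V × V')` agreeing on all `ι⁻¹(x, y)` are equal. [folklore] -/
private theorem ext_symm_mk {f g : Module.End ℂ (ℂ ⊗[ℚ] (V × V'))}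
    (h : ∀ (x : ℂ ⊗[ℚ] V) (y : ℂ ⊗[ℚ] V'), f ((prodEquiv V V').symm (x, y)) = g ((prodEquiv V V').symm (x, y))) : f = g := by
  refine LinearMap.ext fun z => ?_
  obtain ⟨⟨x, y⟩, rfl⟩ := (prodEquiv V V').symm.surjective z
  exact h x y

/-- **Multiplicativity `(A ⊕ B)(A' ⊕ B') = AA' ⊕ BB'`.** [cite: CattaniElZeinGriffithsLe2014, Thm. 3.2.18] -/
theorem prodEnd_mul : prodEnd (A * A') (B * B') = prodEnd A B * prodEnd A' B' :=
  ext_symm_mk fun x y => by simp only [Module.End.mul_apply, prodEnd_symm_mk]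

/-- `1 ⊕ 1 = 1`. [cite: CattaniElZeinGriffithsLe2014, Thm. 3.2.18] -/
@[simp]
theorem prodEnd_one : prodEnd (1 : Module.End ℂ (ℂ ⊗[ℚ] V)) (1 : Module.End ℂ (ℂ ⊗[ℚ] V')) = 1 :=
  ext_symm_mk fun x y => by simp only [prodEnd_symm_mk, Module.End.one_apply]

/-- **Additivity `(A + A') ⊕ (B + B') = (A ⊕ B) + (A' ⊕ B')`.** [cite: CattaniElZeinGriffithsLe2014, Thm. 3.2.18] -/
theorem prodEnd_add : prodEnd (A + A') (B + B') = prodEnd A B + prodEnd A' B' :=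
  ext_symm_mk fun x y => by simp only [prodEnd_symm_mk, LinearMap.add_apply, ← map_add, Prod.mk_add_mk]

/-- `0 ⊕ 0 = 0`. [cite: CattaniElZeinGriffithsLe2014, Thm. 3.2.18] -/
@[simp]
theorem prodEnd_zero : prodEnd (0 : Module.End ℂ (ℂ ⊗[ℚ] V)) (0 : Module.End ℂ (ℂ ⊗[ℚ] V')) = 0 :=
  ext_symm_mk fun x y => by simp only [prodEnd_symm_mk, LinearMap.zero_apply, Prod.mk_zero_zero, map_zero]

/-- Homogeneity `(c A) ⊕ (c B) = c (A ⊕ B)`. [cite: CattaniElZeinGriffithsLe2014, Thm. 3.2.18] -/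
theorem prodEnd_smul (c : ℂ) : prodEnd (c • A) (c • B) = c • prodEnd A B :=
  ext_symm_mk fun x y => by simp only [prodEnd_symm_mk, LinearMap.smul_apply, ← map_smul, Prod.smul_mk]

/-- `(-A) ⊕ (-B) = -(A ⊕ B)`. [cite: CattaniElZeinGriffithsLe2014, Thm. 3.2.18] -/
theorem prodEnd_neg : prodEnd (-A) (-B) = -prodEnd A B :=
  ext_symm_mk fun x y => by simp only [prodEnd_symm_mk, LinearMap.neg_apply, ← map_neg, Prod.neg_mk]

/-- `(A - A') ⊕ (B - B') = (A ⊕ B) - (A' ⊕ B')`. [cite: CattaniElZeinGriffithsLe2014, Thm. 3.2.18] -/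
theorem prodEnd_sub : prodEnd (A - A') (B - B') = prodEnd A B - prodEnd A' B' := by
  rw [sub_eq_add_neg, sub_eq_add_neg, prodEnd_add, prodEnd_neg, ← sub_eq_add_neg]

/-- **The block splitting `A ⊕ B = (A ⊕ 0) + (0 ⊕ B)`.** [cite: CattaniElZeinGriffithsLe2014, Thm. 3.2.18] -/
theorem prodEnd_eq_add : prodEnd A B = prodEnd A (0 : Module.End ℂ (ℂ ⊗[ℚ] V')) + prodEnd (0 : Module.End ℂ (ℂ ⊗[ℚ] V)) B := by
  rw [← prodEnd_add, add_zero, zero_add]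

/-- Powers: `(A ⊕ B)^n = A^n ⊕ B^n`. [cite: CattaniElZeinGriffithsLe2014, Thm. 3.2.18] -/
theorem prodEnd_pow (n : ℕ) : prodEnd A B ^ n = prodEnd (A ^ n) (B ^ n) := by
  induction n with
  | zero => rw [pow_zero, pow_zero, pow_zero, prodEnd_one]
  | succ n ih => rw [pow_succ, pow_succ, pow_succ, ih, prodEnd_mul]

/-- `A ⊕ B` and `A' ⊕ B'` commute when the blocks do. [cite: CattaniElZeinGriffithsLe2014, Thm. 3.2.18] -/
theorem commute_prodEnd {A A' : Module.End ℂ (ℂ ⊗[ℚ] V)} {B B' : Module.End ℂ (ℂ ⊗[ℚ] V')} (hA : Commute A A') (hB : Commute B B') :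
    Commute (prodEnd A B) (prodEnd A' B') := by
  rw [Commute, SemiconjBy, ← prodEnd_mul, ← prodEnd_mul, hA.eq, hB.eq]

/-- **The blocks `A ⊕ 0` and `0 ⊕ B` commute.** [cite: CattaniElZeinGriffithsLe2014, Thm. 3.2.18] -/
theorem commute_prodEnd_zero_zero_prodEnd :
    Commute (prodEnd A (0 : Module.End ℂ (ℂ ⊗[ℚ] V'))) (prodEnd (0 : Module.End ℂ (ℂ ⊗[ℚ] V)) B) :=
  commute_prodEnd (Commute.zero_right A) (Commute.zero_left B)

/-- **`A ⊕ B = A' ⊕ B' ↔ A = A' ∧ B = B'`** (the blocks are recovered on `ι⁻¹(x, 0)` and `ι⁻¹(0, y)`). [cite: CattaniElZeinGriffithsLe2014, Thm. 3.2.18] -/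
theorem prodEnd_inj {A A' : Module.End ℂ (ℂ ⊗[ℚ] V)} {B B' : Module.End ℂ (ℂ ⊗[ℚ] V')} :
    prodEnd A B = prodEnd A' B' ↔ A = A' ∧ B = B' := by
  refine ⟨fun h => ⟨LinearMap.ext fun x => ?_, LinearMap.ext fun y => ?_⟩, fun h => by rw [h.1, h.2]⟩
  · have hx := congrArg (fun T => (prodEquiv V V' (T ((prodEquiv V V').symm (x, 0)))).1) h
    simpa only [prodEnd_symm_mk, LinearEquiv.apply_symm_apply] using hx
  · have hy := congrArg (fun T => (prodEquiv V V' (T ((prodEquiv V V').symm (0, y)))).2) h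
    simpa only [prodEnd_symm_mk, LinearEquiv.apply_symm_apply] using hy

/-- `A ⊕ B = 0 ↔ A = 0 ∧ B = 0`. [cite: CattaniElZeinGriffithsLe2014, Thm. 3.2.18] -/
theorem prodEnd_eq_zero_iff {A : Module.End ℂ (ℂ ⊗[ℚ] V)} {B : Module.End ℂ (ℂ ⊗[ℚ] V')} : prodEnd A B = 0 ↔ A = 0 ∧ B = 0 := by
  rw [← prodEnd_zero, prodEnd_inj]

/-- **`A ⊕ B` is nilpotent iff `A` and `B` are** (`(A ⊕ B)^n = A^n ⊕ B^n`; e.g. `N₁ ⊕ N₂`). [cite: Deligne1980, (1.6.7)] -/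
theorem isNilpotent_prodEnd_iff {A : Module.End ℂ (ℂ ⊗[ℚ] V)} {B : Module.End ℂ (ℂ ⊗[ℚ] V')} :
    IsNilpotent (prodEnd A B) ↔ IsNilpotent A ∧ IsNilpotent B := by
  constructor
  · rintro ⟨n, hn⟩
    rw [prodEnd_pow, prodEnd_eq_zero_iff] at hn
    exact ⟨⟨n, hn.1⟩, ⟨n, hn.2⟩⟩
  · rintro ⟨⟨n, hn⟩, ⟨m, hm⟩⟩
    refine ⟨n + m, ?_⟩
    rw [prodEnd_pow, pow_add, hn, zero_mul, pow_add, hm, mul_zero, prodEnd_zero]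

/-- `A ⊕ B` is nilpotent when `A` and `B` are. [cite: Deligne1980, (1.6.7)] -/
theorem isNilpotent_prodEnd {A : Module.End ℂ (ℂ ⊗[ℚ] V)} {B : Module.End ℂ (ℂ ⊗[ℚ] V')} (hA : IsNilpotent A) (hB : IsNilpotent B) :
    IsNilpotent (prodEnd A B) :=
  isNilpotent_prodEnd_iff.2 ⟨hA, hB⟩

/-- **The ring homomorphism `(A, B) ↦ A ⊕ B`, `End(V_ℂ) × End(V'_ℂ) → End((V × V')_ℂ)`** (the block-diagonal embedding).
[cite: CattaniElZeinGriffithsLe2014, Thm. 3.2.18] -/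
def prodEndRingHom : Module.End ℂ (ℂ ⊗[ℚ] V) × Module.End ℂ (ℂ ⊗[ℚ] V') →+* Module.End ℂ (ℂ ⊗[ℚ] (V × V')) where
  toFun AB := prodEnd AB.1 AB.2
  map_one' := prodEnd_one
  map_mul' AB AB' := prodEnd_mul AB.1 AB'.1 AB.2 AB'.2
  map_zero' := prodEnd_zero
  map_add' AB AB' := prodEnd_add AB.1 AB'.1 AB.2 AB'.2

/-- `prodEndRingHom (A, B) = A ⊕ B`. [cite: CattaniElZeinGriffithsLe2014, Thm. 3.2.18] -/
@[simp]
theorem prodEndRingHom_apply (AB : Module.End ℂ (ℂ ⊗[ℚ] V) × Module.End ℂ (ℂ ⊗[ℚ] V')) : prodEndRingHom AB = prodEnd AB.1 AB.2 := rfl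

/-- **`A ⊕ B` is invertible when `A` and `B` are** (inverse `A⁻¹ ⊕ B⁻¹`). [cite: CattaniElZeinGriffithsLe2014, Thm. 3.2.18] -/
theorem isUnit_prodEnd {A : Module.End ℂ (ℂ ⊗[ℚ] V)} {B : Module.End ℂ (ℂ ⊗[ℚ] V')} (hA : IsUnit A) (hB : IsUnit B) :
    IsUnit (prodEnd A B) :=
  (Prod.isUnit_iff.2 ⟨hA, hB⟩ : IsUnit (A, B)).map prodEndRingHom

/-- A pair of nilpotents is nilpotent in the product ring. [folklore] -/
private theorem isNilpotent_prodMk {R S : Type*} [MonoidWithZero R] [MonoidWithZero S] {a : R} {b : S} (ha : IsNilpotent a)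
    (hb : IsNilpotent b) : IsNilpotent (a, b) := by
  obtain ⟨n, hn⟩ := ha
  obtain ⟨m, hm⟩ := hb
  exact ⟨n + m, Prod.ext (by rw [Prod.pow_fst, pow_add, hn, zero_mul, Prod.fst_zero])
    (by rw [Prod.pow_snd, pow_add, hm, mul_zero, Prod.snd_zero])⟩

/-- The exponential of a pair in a product ring is the pair of exponentials. [folklore] -/
private theorem exp_prodMk {R S : Type*} [Ring R] [Ring S] [Module ℚ R] [Module ℚ S] {a : R} {b : S} (ha : IsNilpotent a)
    (hb : IsNilpotent b) : IsNilpotent.exp (a, b) = (IsNilpotent.exp a, IsNilpotent.exp b) :=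
  Prod.ext (IsNilpotent.map_exp (isNilpotent_prodMk ha hb) (RingHom.fst R S))
    (IsNilpotent.map_exp (isNilpotent_prodMk ha hb) (RingHom.snd R S))

/-- **`exp(A ⊕ B) = e^A ⊕ e^B`** for nilpotent `A`, `B` (`(A, B) ↦ A ⊕ B` is a ring homomorphism) — e.g. `e^{z(N₁ ⊕ N₂)} = e^{zN₁} ⊕ e^{zN₂}`
along a nilpotent orbit, `exp(Γ₁(s) ⊕ Γ₂(s)) = e^{Γ₁(s)} ⊕ e^{Γ₂(s)}` for holomorphic gauges.
[cite: CattaniElZeinGriffithsLe2014, Thm. 3.2.18 and Def. 7.5.4] [cite: Deligne1980, (1.6.7)] -/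
theorem exp_prodEnd {A : Module.End ℂ (ℂ ⊗[ℚ] V)} {B : Module.End ℂ (ℂ ⊗[ℚ] V')} (hA : IsNilpotent A) (hB : IsNilpotent B) :
    IsNilpotent.exp (prodEnd A B) = prodEnd (IsNilpotent.exp A) (IsNilpotent.exp B) := by
  have h := IsNilpotent.map_exp (isNilpotent_prodMk hA hB) (prodEndRingHom (V := V) (V' := V'))
  rw [exp_prodMk hA hB, prodEndRingHom_apply, prodEndRingHom_apply] at h
  exact h.symm

/-- **Reality: `conj(A ⊕ B) = Ā ⊕ B̄`** — complex conjugation of endomorphisms (`endConj T = conj ∘ T ∘ conj`) is componentwise under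
`prodEquiv`; in particular `A ⊕ B` is defined over `ℝ` when `A` and `B` are. [cite: DeligneHodgeII1971, 2.1.4] [cite: KatoUsui2009, §6.1.2] -/
theorem endConj_prodEnd : endConj (prodEnd A B) = prodEnd (endConj A) (endConj B) :=
  ext_symm_mk fun x y => by
    rw [endConj_apply, conj_prodEquiv_symm, prodEnd_symm_mk, conj_prodEquiv_symm, prodEnd_symm_mk, endConj_apply, endConj_apply]

/-- `A ⊕ B` is real if `A` and `B` are. [cite: KatoUsui2009, §6.1.2] -/
theorem endConj_prodEnd_of_eq {A : Module.End ℂ (ℂ ⊗[ℚ] V)} {B : Module.End ℂ (ℂ ⊗[ℚ] V')} (hA : endConj A = A) (hB : endConj B = B) :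
    endConj (prodEnd A B) = prodEnd A B := by
  rw [endConj_prodEnd, hA, hB]

end Algebra

/-! ### Base change: `(f ⊕ g)_ℂ = f_ℂ ⊕ g_ℂ`; the rational exponential `exp(N₁ ⊕ N₂) = e^{N₁} ⊕ e^{N₂}` -/

section BaseChange

/-- `ι ((f ⊕ g)_ℂ z) = (f_ℂ (ι z)₁, g_ℂ (ι z)₂)`. [cite: CattaniElZeinGriffithsLe2014, Ex. 3.2.23 (2)] -/
theorem prodEquiv_prodMap_baseChange_apply (f : V →ₗ[ℚ] V) (g : V' →ₗ[ℚ] V') (z : ℂ ⊗[ℚ] (V × V')) :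
    prodEquiv V V' ((f.prodMap g).baseChange ℂ z) = (f.baseChange ℂ (prodEquiv V V' z).1, g.baseChange ℂ (prodEquiv V V' z).2) := by
  induction z using TensorProduct.induction_on with
  | zero => simp only [map_zero, Prod.fst_zero, Prod.snd_zero, Prod.mk_zero_zero]
  | tmul c vw =>
    obtain ⟨v, w⟩ := vw
    simp [prodEquiv, LinearMap.baseChange_tmul]
  | add x y hx hy => simp only [map_add, hx, hy, Prod.fst_add, Prod.snd_add, Prod.mk_add_mk]

/-- **`(f ⊕ g)_ℂ = f_ℂ ⊕ g_ℂ`**: the complexification of `LinearMap.prodMap f g : V × V' → V × V'` is `f_ℂ ⊕ g_ℂ` under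
`(V × V')_ℂ = V_ℂ × V'_ℂ` (extension of scalars commutes with direct sums). [cite: CattaniElZeinGriffithsLe2014, Ex. 3.2.23 (2)] [cite: DeligneHodgeII1971, 2.1] -/
theorem baseChange_prodMap_eq_prodEnd (f : V →ₗ[ℚ] V) (g : V' →ₗ[ℚ] V') :
    (f.prodMap g).baseChange ℂ = prodEnd (f.baseChange ℂ) (g.baseChange ℂ) := by
  refine LinearMap.ext fun z => ?_
  rw [prodEnd_apply, LinearEquiv.eq_symm_apply, prodEquiv_prodMap_baseChange_apply]

/-- `(f ⊕ g)^j = f^j ⊕ g^j` (the tree's `Motives.prodMap_pow` of `FamiliesVHSTensorMonodromy`, not imported here: VHS closure). [folklore] -/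
private theorem prodMap_pow' (f : V →ₗ[ℚ] V) (g : V' →ₗ[ℚ] V') (j : ℕ) : f.prodMap g ^ j = (f ^ j).prodMap (g ^ j) := by
  induction j with
  | zero => rw [pow_zero, pow_zero, pow_zero, LinearMap.prodMap_one]
  | succ j ih => rw [pow_succ, ih, pow_succ, pow_succ, LinearMap.prodMap_mul]

/-- `f ⊕ g` is nilpotent iff `f` and `g` are. [cite: Deligne1980, (1.6.7)] -/
theorem isNilpotent_prodMap_iff {f : V →ₗ[ℚ] V} {g : V' →ₗ[ℚ] V'} : IsNilpotent (f.prodMap g) ↔ IsNilpotent f ∧ IsNilpotent g := by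
  constructor
  · rintro ⟨n, hn⟩
    rw [prodMap_pow'] at hn
    refine ⟨⟨n, LinearMap.ext fun x => ?_⟩, ⟨n, LinearMap.ext fun y => ?_⟩⟩
    · simpa using congrArg (fun T => (T (x, 0)).1) hn
    · simpa using congrArg (fun T => (T (0, y)).2) hn
  · rintro ⟨⟨n, hn⟩, ⟨m, hm⟩⟩
    exact ⟨n + m, by rw [prodMap_pow', pow_add, hn, zero_mul, pow_add, hm, mul_zero, LinearMap.prodMap_zero]⟩

/-- **`exp(N₁ ⊕ N₂) = e^{N₁} ⊕ e^{N₂}`** for nilpotent `ℚ`-linear `N₁`, `N₂` (Mathlib's ring homomorphism `LinearMap.prodMapRingHom`): the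
unipotent monodromy of a direct sum is the direct sum of the monodromies. [cite: Deligne1980, (1.6.7)] [cite: Kato2013, §2.1, 6] -/
theorem exp_prodMap {N₁ : V →ₗ[ℚ] V} {N₂ : V' →ₗ[ℚ] V'} (h₁ : IsNilpotent N₁) (h₂ : IsNilpotent N₂) :
    IsNilpotent.exp (N₁.prodMap N₂) = (IsNilpotent.exp N₁).prodMap (IsNilpotent.exp N₂) := by
  have h := IsNilpotent.map_exp (isNilpotent_prodMk h₁ h₂) (LinearMap.prodMapRingHom ℚ V V')
  rw [exp_prodMk h₁ h₂] at h
  exact h.symm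

end BaseChange

/-! ## §2 Subspaces: `(A ⊕ B)(S × U) = A S × B U`, the product filtrations, and `𝔤𝔩(H₁ ⊕ H₂)^{a,b}` -/

section Subspaces

variable (A : Module.End ℂ (ℂ ⊗[ℚ] V)) (B : Module.End ℂ (ℂ ⊗[ℚ] V'))

/-- **`(A ⊕ B)(S × U) = A S × B U`** for subspaces `S ⊂ V_ℂ`, `U ⊂ V'_ℂ` (read in `ℂ ⊗ (V × V')` through `prodEquiv`).
[cite: CattaniElZeinGriffithsLe2014, Thm. 3.2.18 and Ex. 3.2.23 (2)] -/
theorem map_prodEnd_comap_prod (S : Submodule ℂ (ℂ ⊗[ℚ] V)) (U : Submodule ℂ (ℂ ⊗[ℚ] V')) :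
    ((S.prod U).comap (prodEquiv V V' : ℂ ⊗[ℚ] (V × V') →ₗ[ℂ] _)).map (prodEnd A B) =
      ((S.map A).prod (U.map B)).comap (prodEquiv V V' : ℂ ⊗[ℚ] (V × V') →ₗ[ℂ] _) := by
  ext z
  simp only [Submodule.mem_map, Submodule.mem_comap, LinearEquiv.coe_coe, Submodule.mem_prod]
  constructor
  · rintro ⟨w, ⟨hw₁, hw₂⟩, rfl⟩
    rw [prodEquiv_prodEnd_apply]
    exact ⟨⟨_, hw₁, rfl⟩, ⟨_, hw₂, rfl⟩⟩
  · rintro ⟨⟨x, hx, hx'⟩, ⟨y, hy, hy'⟩⟩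
    refine ⟨(prodEquiv V V').symm (x, y), ?_, ?_⟩
    · rw [LinearEquiv.apply_symm_apply]; exact ⟨hx, hy⟩
    · apply (prodEquiv V V').injective
      rw [prodEnd_symm_mk, LinearEquiv.apply_symm_apply, hx', hy', Prod.mk.eta]

/-- **`(A ⊕ B)⁻¹(S × U) = A⁻¹S × B⁻¹U`.** [cite: CattaniElZeinGriffithsLe2014, Thm. 3.2.18 and Ex. 3.2.23 (2)] -/
theorem comap_prodEnd_comap_prod (S : Submodule ℂ (ℂ ⊗[ℚ] V)) (U : Submodule ℂ (ℂ ⊗[ℚ] V')) :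
    ((S.prod U).comap (prodEquiv V V' : ℂ ⊗[ℚ] (V × V') →ₗ[ℂ] _)).comap (prodEnd A B) =
      ((S.comap A).prod (U.comap B)).comap (prodEquiv V V' : ℂ ⊗[ℚ] (V × V') →ₗ[ℂ] _) := by
  ext z
  simp only [Submodule.mem_comap, LinearEquiv.coe_coe, Submodule.mem_prod, prodEquiv_prodEnd_apply]

/-- `(A ⊕ B)(S × U) ⊆ S' × U'` when `A S ⊆ S'` and `B U ⊆ U'`. [cite: CattaniElZeinGriffithsLe2014, Thm. 3.2.18] -/
theorem map_prodEnd_comap_prod_le {S S' : Submodule ℂ (ℂ ⊗[ℚ] V)} {U U' : Submodule ℂ (ℂ ⊗[ℚ] V')} (hA : S.map A ≤ S') (hB : U.map B ≤ U') :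
    ((S.prod U).comap (prodEquiv V V' : ℂ ⊗[ℚ] (V × V') →ₗ[ℂ] _)).map (prodEnd A B) ≤
      (S'.prod U').comap (prodEquiv V V' : ℂ ⊗[ℚ] (V × V') →ₗ[ℂ] _) := by
  rw [map_prodEnd_comap_prod]
  exact Submodule.comap_mono (Submodule.prod_mono hA hB)

/-- For pure Hodge structures of the same weight: **`(A ⊕ B) F^p(H₁ ⊕ H₂) = A F^p(H₁) × B F^p(H₂)`** (the tree's `HodgeStructure.prod`).
[cite: DeligneHodgeII1971, 2.1] -/
theorem map_prodEnd_hodgeStructure_prod_F {n : ℤ} (H₁ : HodgeStructure V n) (H₂ : HodgeStructure V' n) (p : ℤ) :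
    ((H₁.prod H₂).F p).map (prodEnd A B) = (((H₁.F p).map A).prod ((H₂.F p).map B)).comap (prodEquiv V V' : ℂ ⊗[ℚ] (V × V') →ₗ[ℂ] _) :=
  map_prodEnd_comap_prod A B (H₁.F p) (H₂.F p)

variable (H₁ : MixedHodgeStructure V) (H₂ : MixedHodgeStructure V')

/-- **`(A ⊕ B) F^p(H₁ ⊕ H₂) = A F^p(H₁) × B F^p(H₂)`** for mixed Hodge structures. [cite: CattaniElZeinGriffithsLe2014, Ex. 3.2.23 (2)] -/
theorem map_prodEnd_prod_F (p : ℤ) :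
    ((H₁.prod H₂).F p).map (prodEnd A B) = (((H₁.F p).map A).prod ((H₂.F p).map B)).comap (prodEquiv V V' : ℂ ⊗[ℚ] (V × V') →ₗ[ℂ] _) := by
  rw [MixedHodgeStructure.prod_F, map_prodEnd_comap_prod]

/-- **Maps of degree `a` on the factors give a map of degree `a` on the sum: if `A F^p ⊂ F^{p+a}` and `B F^p ⊂ F^{p+a}` then
`(A ⊕ B) F^p(H₁ ⊕ H₂) ⊂ F^{p+a}(H₁ ⊕ H₂)`** (e.g. `N₁ ⊕ N₂` lowers `F` by one). [cite: CattaniElZeinGriffithsLe2014, Thm. 3.2.18 and Ex. 3.2.23 (2)] -/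
theorem map_prodEnd_prod_F_le {a : ℤ} (hA : ∀ p, (H₁.F p).map A ≤ H₁.F (p + a)) (hB : ∀ p, (H₂.F p).map B ≤ H₂.F (p + a)) (p : ℤ) :
    ((H₁.prod H₂).F p).map (prodEnd A B) ≤ (H₁.prod H₂).F (p + a) := by
  rw [MixedHodgeStructure.prod_F, MixedHodgeStructure.prod_F]
  exact map_prodEnd_comap_prod_le A B (hA p) (hB p)

/-- **The same for the weight filtration: if `A W_{i,ℂ} ⊂ W_{i+a,ℂ}` and `B W_{i,ℂ} ⊂ W_{i+a,ℂ}` then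
`(A ⊕ B) W_i(H₁ ⊕ H₂)_ℂ ⊂ W_{i+a}(H₁ ⊕ H₂)_ℂ`.** [cite: CattaniElZeinGriffithsLe2014, Thm. 3.2.18 and Ex. 3.2.23 (2)] [cite: Deligne1980, (1.6.7)] -/
theorem map_prodEnd_baseChange_prod_W_le {a : ℤ} (hA : ∀ i, ((H₁.W i).baseChange ℂ).map A ≤ (H₁.W (i + a)).baseChange ℂ)
    (hB : ∀ i, ((H₂.W i).baseChange ℂ).map B ≤ (H₂.W (i + a)).baseChange ℂ) (i : ℤ) :
    (((H₁.prod H₂).W i).baseChange ℂ).map (prodEnd A B) ≤ ((H₁.prod H₂).W (i + a)).baseChange ℂ := by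
  rw [MixedHodgeStructure.prod_W, MixedHodgeStructure.prod_W, MixedHodgeStructure.baseChange_prod, MixedHodgeStructure.baseChange_prod]
  exact map_prodEnd_comap_prod_le A B (hA i) (hB i)

/-- `(A ⊕ B) I^{p,q}(H₁ ⊕ H₂) = A I^{p,q}(H₁) × B I^{p,q}(H₂)` (Deligne's bigrading of a direct sum is the direct sum of the bigradings).
[cite: CattaniElZeinGriffithsLe2014, Thm. 7.5.6] -/
theorem map_prodEnd_prod_deligneI (p q : ℤ) :
    ((H₁.prod H₂).deligneI p q).map (prodEnd A B) =
      (((H₁.deligneI p q).map A).prod ((H₂.deligneI p q).map B)).comap (prodEquiv V V' : ℂ ⊗[ℚ] (V × V') →ₗ[ℂ] _) := by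
  rw [MixedHodgeStructure.deligneI_prod, map_prodEnd_comap_prod]

/-- **Thm. 7.5.6 / (7.6.2) for block-diagonal endomorphisms: `A ⊕ B ∈ 𝔤𝔩(H₁ ⊕ H₂)^{a,b} ↔ A ∈ 𝔤𝔩(H₁)^{a,b} ∧ B ∈ 𝔤𝔩(H₂)^{a,b}`** —
`I^{p,q}(H₁ ⊕ H₂) = I^{p,q}(H₁) × I^{p,q}(H₂)` and `A ⊕ B` acts blockwise. [cite: CattaniElZeinGriffithsLe2014, Thm. 7.5.6 and (7.6.2)] -/
theorem prodEnd_mem_endPiece_iff {a b : ℤ} : prodEnd A B ∈ (H₁.prod H₂).endPiece a b ↔ A ∈ H₁.endPiece a b ∧ B ∈ H₂.endPiece a b := by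
  simp only [MixedHodgeStructure.mem_endPiece_iff]
  constructor
  · intro h
    refine ⟨fun p q => ?_, fun p q => ?_⟩
    · rintro _ ⟨x, hx, rfl⟩
      have hz : (prodEquiv V V').symm (x, 0) ∈ (H₁.prod H₂).deligneI p q := by
        rw [MixedHodgeStructure.mem_deligneI_prod_iff, LinearEquiv.apply_symm_apply]
        exact ⟨hx, Submodule.zero_mem _⟩
      have h' := h p q ⟨_, hz, rfl⟩
      rw [prodEnd_symm_mk, MixedHodgeStructure.mem_deligneI_prod_iff, LinearEquiv.apply_symm_apply] at h'
      exact h'.1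
    · rintro _ ⟨y, hy, rfl⟩
      have hz : (prodEquiv V V').symm (0, y) ∈ (H₁.prod H₂).deligneI p q := by
        rw [MixedHodgeStructure.mem_deligneI_prod_iff, LinearEquiv.apply_symm_apply]
        exact ⟨Submodule.zero_mem _, hy⟩
      have h' := h p q ⟨_, hz, rfl⟩
      rw [prodEnd_symm_mk, MixedHodgeStructure.mem_deligneI_prod_iff, LinearEquiv.apply_symm_apply] at h'
      exact h'.2
  · rintro ⟨hA, hB⟩ p q
    rw [map_prodEnd_prod_deligneI, MixedHodgeStructure.deligneI_prod]
    exact Submodule.comap_mono (Submodule.prod_mono (hA p q) (hB p q))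

/-- `A ∈ 𝔤𝔩(H₁)^{a,b}`, `B ∈ 𝔤𝔩(H₂)^{a,b}` ⟹ `A ⊕ B ∈ 𝔤𝔩(H₁ ⊕ H₂)^{a,b}` (e.g. the monodromy logarithm `N₁ ⊕ N₂` is again a
`(−1,−1)`-morphism). [cite: CattaniElZeinGriffithsLe2014, Thm. 7.5.6 and (7.6.2)] -/
theorem prodEnd_mem_endPiece {a b : ℤ} (hA : A ∈ H₁.endPiece a b) (hB : B ∈ H₂.endPiece a b) : prodEnd A B ∈ (H₁.prod H₂).endPiece a b :=
  (prodEnd_mem_endPiece_iff A B H₁ H₂).2 ⟨hA, hB⟩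

/-- `A ⊕ 0 ∈ 𝔤𝔩(H₁ ⊕ H₂)^{a,b}` for `A ∈ 𝔤𝔩(H₁)^{a,b}`. [cite: CattaniElZeinGriffithsLe2014, Thm. 7.5.6 and (7.6.2)] -/
theorem prodEnd_zero_mem_endPiece {a b : ℤ} (hA : A ∈ H₁.endPiece a b) :
    prodEnd A (0 : Module.End ℂ (ℂ ⊗[ℚ] V')) ∈ (H₁.prod H₂).endPiece a b :=
  prodEnd_mem_endPiece A 0 H₁ H₂ hA (Submodule.zero_mem _)

/-- `0 ⊕ B ∈ 𝔤𝔩(H₁ ⊕ H₂)^{a,b}` for `B ∈ 𝔤𝔩(H₂)^{a,b}`. [cite: CattaniElZeinGriffithsLe2014, Thm. 7.5.6 and (7.6.2)] -/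
theorem zero_prodEnd_mem_endPiece {a b : ℤ} (hB : B ∈ H₂.endPiece a b) :
    prodEnd (0 : Module.End ℂ (ℂ ⊗[ℚ] V)) B ∈ (H₁.prod H₂).endPiece a b :=
  prodEnd_mem_endPiece 0 B H₁ H₂ (Submodule.zero_mem _) hB

/-- **Sums of pieces: `A ∈ ⊕_{(a,b) ∈ P} 𝔤𝔩(H₁)^{a,b}`, `B ∈ ⊕_{(a,b) ∈ P} 𝔤𝔩(H₂)^{a,b}` ⟹ `A ⊕ B ∈ ⊕_{(a,b) ∈ P} 𝔤𝔩(H₁ ⊕ H₂)^{a,b}`**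
(`A ↦ A ⊕ 0` and `B ↦ 0 ⊕ B` are linear and respect the pieces; e.g. `P = {a ≤ -1}`: the sub-algebra `𝔟 = ⊕_{a ≤ -1} 𝔤𝔩^{a,b}` of
holomorphic gauges, or `P = {a, b < 0}`: `Λ^{-1,-1}`). [cite: CattaniElZeinGriffithsLe2014, Thm. 7.5.6 and (7.6.2)] -/
theorem prodEnd_mem_biSup_endPiece {P : Set (ℤ × ℤ)} (hA : A ∈ ⨆ ab ∈ P, H₁.endPiece ab.1 ab.2) (hB : B ∈ ⨆ ab ∈ P, H₂.endPiece ab.1 ab.2) :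
    prodEnd A B ∈ ⨆ ab ∈ P, (H₁.prod H₂).endPiece ab.1 ab.2 := by
  -- `A ↦ A ⊕ 0` and `B ↦ 0 ⊕ B` are linear and carry `𝔤𝔩^{a,b}` into `𝔤𝔩(H₁ ⊕ H₂)^{a,b}`
  let l : Module.End ℂ (ℂ ⊗[ℚ] V) →ₗ[ℂ] Module.End ℂ (ℂ ⊗[ℚ] (V × V')) :=
    { toFun := fun A => prodEnd A (0 : Module.End ℂ (ℂ ⊗[ℚ] V'))
      map_add' := fun A A' => by rw [← prodEnd_add, add_zero]
      map_smul' := fun c A => by rw [RingHom.id_apply, ← prodEnd_smul, smul_zero] }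
  let r : Module.End ℂ (ℂ ⊗[ℚ] V') →ₗ[ℂ] Module.End ℂ (ℂ ⊗[ℚ] (V × V')) :=
    { toFun := fun B => prodEnd (0 : Module.End ℂ (ℂ ⊗[ℚ] V)) B
      map_add' := fun B B' => by rw [← prodEnd_add, add_zero]
      map_smul' := fun c B => by rw [RingHom.id_apply, ← prodEnd_smul, smul_zero] }
  have hl : (⨆ ab ∈ P, H₁.endPiece ab.1 ab.2).map l ≤ ⨆ ab ∈ P, (H₁.prod H₂).endPiece ab.1 ab.2 := by
    simp only [Submodule.map_iSup]
    exact iSup₂_mono fun ab _ => Submodule.map_le_iff_le_comap.2 fun A hA => prodEnd_zero_mem_endPiece A H₁ H₂ hA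
  have hr : (⨆ ab ∈ P, H₂.endPiece ab.1 ab.2).map r ≤ ⨆ ab ∈ P, (H₁.prod H₂).endPiece ab.1 ab.2 := by
    simp only [Submodule.map_iSup]
    exact iSup₂_mono fun ab _ => Submodule.map_le_iff_le_comap.2 fun B hB => zero_prodEnd_mem_endPiece B H₁ H₂ hB
  rw [prodEnd_eq_add]
  exact Submodule.add_mem _ (hl (Submodule.mem_map_of_mem hA)) (hr (Submodule.mem_map_of_mem hB))

end Subspaces

end HodgeStructure

end Literature.AlgebraicGeometry.Motives

end
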